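import Summits.CriticalPhenomena.SAWScalingLimit.Theses.SAWTwistedSelfEnergy
import Summits.CriticalPhenomena.SAWScalingLimit.Theorems.SAWTwistedSelfEnergyEventualTightOfUMA
import HarnessLib

/-!
# Line `SketchIdeator2_1881` — skeleton for the crux `SAWTwistedSelfEnergy.EventualTight`
(stmt-CriticalPhenomena-1881), lead `prover-line-stmt-CriticalPhenomena-1881-0`, registration v2

Card `unordered-markov-fibres` ("condition on WHERE, not WHEN"), crux-ideate r1 k2.  v2 = v1 with the whole
composition LANDED: `Theorems.EventualTightUMA.EventualTight_of_uma` (p158646,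
`Theorems/SAWTwistedSelfEnergyEventualTightOfUMA.lean`: fibre decomposition of the discrete `x_c`-law along any
map, the one-scale step `fine_of_coarse_of_atom`, induction down the scale ranges `(R₀/2ⁿ, R₀]` with the free base
`not_hasTraversals_far`, landed `shellCrossing_of_perShellDecay` + `TightOfShellCrossing_proof` + bridge
`isTightAlongMesh_of_isTightMeasureSet_image`).  ONE registered stub, unchanged from v1:

* `stub_UMA` — the unordered-Markov fibre atom (self-contained signature): for every Dobrushin domain with an
  endpoint approximation, every centre `y`, scale `s`, inner aspect `t ∈ (0,1)`, coarse budget `m` and `θ > 0`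
  there are `k, δ₀` such that for every mesh `δ ≤ δ₀` and EVERY reference walk `γ₀` (every fibre of the outside
  trace at radius `2s`: same lattice edges among the edges having an endpoint at mesh distance `≥ 2s` from `y`),
  the critical SAW law gives the JOINT event "`k` separate traversals of `D(y; ts, s)` but `< m` of
  `D(y; 6s/5, 2s)`" at most `θ ×` the mass of the fibre.  Size: open-problem.  Anatomy (this lead, cycle 1):
  (a) top-scale instances (`closure Ω ⊆ B(y, 2s)`: one fibre, coarse shell never traversed) ARE plain per-shell
  traversal tightness of the shells `D(y; ts, s)`, which is crux-IMPLIED (crux ⟺ `ShellCrossingBound`, landed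
  `Theorems/ShellCrossingBound/Negative/OfEventualTight.lean`); (b) the AVERAGED form of the atom at every scale
  (`P[T_fine ≥ k ∧ T_coarse < m] ≤ θ`) is trivially crux-implied and, with the induction, crux-EQUIVALENT — so the
  surplus of UMA over the crux is exactly the FIBREWISE uniformity at scales `2s < rad_y(Ω)`; (c) the
  one-deep-piece bulk fibre contains the pure-disc chord atom `PureDiscChordTight` (Aizenman–Burchard regularity of
  one critical SAW chord of a lattice disc = KS Condition G2 for the `x_c`-SAW), for which no tool is in print.

Skeleton theorem: `EventualTight_of : __Registered.stub_UMA → SAWTwistedSelfEnergy.EventualTight :=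
Theorems.EventualTightUMA.EventualTight_of_uma` (the alias is the registered signature keyed by the stub name);
wiring check `example := EventualTight_of stub_UMA`.  When `stub_UMA` lands (as `Theorems/…UMA.lean`,
`--supports`), the closing file is the 3-line `theorem EventualTight_proof := EventualTight_of_uma stub_UMA`.

Disproof read (`Cruxes/EventualTight/Disproof.lean`, cdisprove gen 1, mtime 2026-08-16T05:37Z, no `-- Targets`):
`eventualTight_false_without_endpointLimits` — honoured (endpoint limits are spent inside the landed
`TightOfShellCrossing_proof`; UMA's thresholds are per `(a,b)`); `not_cruxUniformThreshold / not_cruxUniformDomains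
/ not_cruxAllMeshes` — respected (`k, δ₀` depend on `(D,a,b,y,s,t,m,θ)`); `eventualTight_false_without_jordan` (§5
snake) — load-bearing for the atom (the Jordan loop bounds the forced fine count inside `B(y,2s) ∩ Ω`);
`Negative/TightnessNecessary` — ¬crux ⇒ ¬conjunct, but ¬UMA ⇏ ¬crux (UMA is strictly stronger, by (b)).
-/

noncomputable section

open MeasureTheory Filter Topology Set Metric
open scoped ENNReal NNReal unitInterval
open Literature.Probability.RandomPlanarGeometry Literature.Probability.LatticeModels

namespace Summit.CriticalPhenomena.SAWScalingLimit.Cruxes.EventualTight.UMALine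

/-! ## The registered stub -/

/-- **Stub UMA — the unordered-Markov fibre atom** (the ONE open statement of the line; self-contained
signature: the card's `UMA` with `OutAgree y (2s) γ γ₀` and `polyline γ` inlined).  For every Dobrushin
domain with an endpoint approximation, every centre `y`, scale `s > 0`, inner aspect `t ∈ (0,1)`, coarse
budget `m` and `θ > 0` there are a threshold `k` and a mesh bound `δ₀ > 0` such that for every mesh
`δ ∈ (0, δ₀]` and EVERY reference walk `γ₀` the critical SAW law of `Ω_δ` from `a_δ` to `b_δ` gives the set of
walks that (i) use exactly the same lattice edges as `γ₀` among the edges having an endpoint at mesh distance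
`≥ 2s` from `y`, (ii) make `k` separate traversals of the fine shell `D(y; ts, s)` and (iii) do NOT make `m`
separate traversals of the coarse shell `D(y; 6s/5, 2s)`, mass at most `θ ×` the mass of the fibre (i).
Why plausibly true: inside a fibre the law is the exact `x_c`-Gibbs measure on multi-arc fillings of the FIXED
region `B(y,2s) ∩ Ω_δ` with frozen rim data; forcing by rim data or by the Jordan boundary to dive below `6s/5`
is paid in coarse traversals (emptying the joint event) and the Jordan loop bounds the forced fine count; the
voluntary fine traversals of `≤ m/2` deep pieces should be geometrically rare (numerics `Numerics-c1.md`
Table B: `P(T ≥ 4) ≈ 0.04`, `P(T ≥ 6) ≈ 5e-4`, flat in `N`).  Open-problem sized: the one-deep-piece bulk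
fibre is the Aizenman–Burchard regularity of one critical SAW chord of a lattice disc (KS Condition G2 for
the `x_c`-SAW), for which no tool is in print; the top-scale instance is per-shell tightness itself. -/
theorem stub_UMA :
    ∀ (D : DobrushinDomain) (a b : ℝ → Site 2), SAW.IsEndpointApprox D a b →
      ∀ (y : ℂ) (s t : ℝ), 0 < s → 0 < t → t < 1 → ∀ (m : ℕ) (θ : ℝ), 0 < θ →
        ∃ (k : ℕ) (δ₀ : ℝ), 0 < δ₀ ∧ ∀ δ ∈ Set.Ioc (0 : ℝ) δ₀,
          ∀ γ₀ : SAW.DomainSAW D.carrier δ (a δ) (b δ),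
            SAW.law D.carrier δ (a δ) (b δ)
                {γ | (∀ e : Sym2 (Site 2), (∃ v : Site 2, v ∈ e ∧ 2 * s ≤ dist (meshPoint δ v) y) →
                      (e ∈ γ.walk.edges ↔ e ∈ γ₀.walk.edges)) ∧
                  (⟨γ.walk.toCurve (meshPoint δ)⟩ : Curve ℂ).HasTraversals k y (t * s) s ∧
                  ¬ (⟨γ.walk.toCurve (meshPoint δ)⟩ : Curve ℂ).HasTraversals m y (6 * s / 5) (2 * s)}
              ≤ ENNReal.ofReal θ *
                SAW.law D.carrier δ (a δ) (b δ)
                  {γ | ∀ e : Sym2 (Site 2), (∃ v : Site 2, v ∈ e ∧ 2 * s ≤ dist (meshPoint δ v) y) →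
                      (e ∈ γ.walk.edges ↔ e ∈ γ₀.walk.edges)} := by
  sorry

/-! ### Name-keyed alias — the hypothesis of `EventualTight_of`

The native skeleton audit (`#h21_check_skeleton`) admits a hypothesis of the skeleton theorem only if its head
constant is a registered obligation or is NAMED like a declared stub; `__Registered.stub_UMA` is the statement of
`stub_UMA` under that name (device of `Cruxes/EventualTight/Lines/birth.lean`).  `rfl`-equal to the registered
signature. -/
namespace __Registered

/-- Alias of the registered signature of `stub_UMA`, keyed by the stub name. -/
abbrev stub_UMA : Prop :=
  ∀ (D : DobrushinDomain) (a b : ℝ → Site 2), SAW.IsEndpointApprox D a b →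
    ∀ (y : ℂ) (s t : ℝ), 0 < s → 0 < t → t < 1 → ∀ (m : ℕ) (θ : ℝ), 0 < θ →
      ∃ (k : ℕ) (δ₀ : ℝ), 0 < δ₀ ∧ ∀ δ ∈ Set.Ioc (0 : ℝ) δ₀,
        ∀ γ₀ : SAW.DomainSAW D.carrier δ (a δ) (b δ),
          SAW.law D.carrier δ (a δ) (b δ)
              {γ | (∀ e : Sym2 (Site 2), (∃ v : Site 2, v ∈ e ∧ 2 * s ≤ dist (meshPoint δ v) y) →
                    (e ∈ γ.walk.edges ↔ e ∈ γ₀.walk.edges)) ∧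
                (⟨γ.walk.toCurve (meshPoint δ)⟩ : Curve ℂ).HasTraversals k y (t * s) s ∧
                ¬ (⟨γ.walk.toCurve (meshPoint δ)⟩ : Curve ℂ).HasTraversals m y (6 * s / 5) (2 * s)}
            ≤ ENNReal.ofReal θ *
              SAW.law D.carrier δ (a δ) (b δ)
                {γ | ∀ e : Sym2 (Site 2), (∃ v : Site 2, v ∈ e ∧ 2 * s ≤ dist (meshPoint δ v) y) →
                    (e ∈ γ.walk.edges ↔ e ∈ γ₀.walk.edges)}

end __Registered

/-! ## The skeleton theorem: the stub implies the crux, BY NAME -/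

/-- **`SAWTwistedSelfEnergy.EventualTight` from the registered stub** (no `sorry` of its own): the landed glue
`Theorems.EventualTightUMA.EventualTight_of_uma` (p158646), whose hypothesis is the registered signature verbatim.
[cite: AizenmanBurchardDuke1999, Thms 1.1-1.2] -/
theorem EventualTight_of (hUMA : __Registered.stub_UMA) :
    Summit.CriticalPhenomena.SAWScalingLimit.Theses.SAWTwistedSelfEnergy.EventualTight :=
  Summit.CriticalPhenomena.SAWScalingLimit.Theorems.EventualTightUMA.EventualTight_of_uma hUMA

/-- **Wiring check — the crux proof modulo the stub** (becomes the closing file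
`theorem EventualTight_proof := EventualTight_of_uma stub_UMA` when `stub_UMA` lands). -/
example : Summit.CriticalPhenomena.SAWScalingLimit.Theses.SAWTwistedSelfEnergy.EventualTight :=
  EventualTight_of stub_UMA

end Summit.CriticalPhenomena.SAWScalingLimit.Cruxes.EventualTight.UMALine

end
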